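import Mathlib.Combinatorics.SimpleGraph.Walk.Counting
import Mathlib.Combinatorics.SimpleGraph.Paths
import Mathlib.Combinatorics.SimpleGraph.DeleteEdges
import Literature.Probability.RandomPlanarGeometry.SelfAvoidingWalk
import HarnessLib

/-!
# Crux `BoundaryTP2` (route SAWTotalPositivity, stmt-CriticalPhenomena-7115): combinatorial vocabulary

The crux `Summit.CriticalPhenomena.SAWScalingLimit.Theses.SAWTotalPositivity.BoundaryTP2` is typed over
planar domains `Ω ⊆ ℂ` and meshes `δ`, but everything it says concerns the finite graph
`Ω_δ = discreteDomainGraph Ω δ ≤ zdGraph 2` and the fugacity-`x_c` sums over its self-avoiding paths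
(refuter rreview-6d2977b1 / cdisprove-7115: as typed, the crux ranges over essentially every finite
subgraph of `ℤ²`). This reviewed definitions file fixes the graph-theoretic vocabulary in which the line's
skeleton, its stubs and the shared tool identities are stated:

* `pathKernel H x a b = Σ_{γ : a → b self-avoiding path of H} x^{|γ|}` (an `ℝ≥0∞`-valued `tsum` over
  Mathlib's `SimpleGraph.Path`), and `pathKernelOn H x a b S`, the same sum restricted to a set `S` of paths;
* `Interlaced H p₁ p₂ p₃ p₄` — hypothesis (i) of the crux: every path `p₁ → p₃` meets every path `p₂ → p₄`;
  `DisjointPaths H a b c d` — a pairing realisable by vertex-disjoint paths (hypotheses (ii), (iii));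
* `GraphTP2At x` — the crux verbatim on finite subgraphs `H ≤ zdGraph 2` at fugacity `x` (the crux's
  combinatorial core is `GraphTP2At x_c`; the line's transfer lemma is `GraphTP2At x_c → BoundaryTP2`;
  deliberately no parameterless `def … : Prop`, which the gate would relocate as a named fact);
* `InterlacedTP2At x` — the interlacing-only strengthening (hypotheses (ii), (iii) replaced by pairwise
  distinctness), the form an induction on the graph must carry because (ii), (iii) are not inherited by
  sub-instances (disprover's census: (ii), (iii) never load-bearing on 1.2e9 enumerated instances; its
  `Repair.lean`).

Vertex deletion is written with Mathlib's `H.deleteEdges (H.incidenceSet c)` (same vertex type, `c`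
isolated); no new graph operations are introduced. Nothing is proved here (definitions only; the API is in
`SAWTotalPositivityBoundaryTP2Kernel.lean`).
-/

noncomputable section

namespace Summit.CriticalPhenomena.SAWScalingLimit.Theorems.BoundaryTP2

open Literature.Probability.LatticeModels Literature.Probability.RandomPlanarGeometry
open scoped ENNReal

variable {V : Type*}

/-- The fugacity-`x` **self-avoiding path kernel** of a graph `H`:
`Z_H^x(a,b) = Σ_{γ} x^{|γ|}` over the self-avoiding paths `γ : a → b` of `H` (Mathlib `SimpleGraph.Path`),
as an `ℝ≥0∞`-valued unconditional sum (finite whenever `H` has finitely many edges). For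
`H = discreteDomainGraph Ω δ` and `x = x_c` this is `SAW.weight Ω δ a b univ`. [folklore] -/
def pathKernel (H : SimpleGraph V) (x : ℝ) (a b : V) : ℝ≥0∞ :=
  ∑' γ : H.Path a b, ENNReal.ofReal (x ^ γ.1.length)

/-- The path kernel restricted to a set `S` of paths: `Σ_{γ ∈ S} x^{|γ|}`. [folklore] -/
def pathKernelOn (H : SimpleGraph V) (x : ℝ) (a b : V) (S : Set (H.Path a b)) : ℝ≥0∞ :=
  ∑' γ : H.Path a b, S.indicator (fun γ => ENNReal.ofReal (x ^ γ.1.length)) γ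

/-- Hypothesis (i) of `BoundaryTP2` (**interlacing**): every self-avoiding path `p₁ → p₃` of `H` shares a
vertex with every self-avoiding path `p₂ → p₄`. [folklore] -/
def Interlaced (H : SimpleGraph V) (p₁ p₂ p₃ p₄ : V) : Prop :=
  ∀ (P : H.Path p₁ p₃) (Q : H.Path p₂ p₄), ∃ v, v ∈ P.1.support ∧ v ∈ Q.1.support

/-- Hypotheses (ii)/(iii) of `BoundaryTP2`: the pairing `(a b | c d)` is **realisable by vertex-disjoint
self-avoiding paths** `a → b`, `c → d` of `H`. [folklore] -/
def DisjointPaths (H : SimpleGraph V) (a b c d : V) : Prop :=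
  ∃ (P : H.Path a b) (Q : H.Path c d), List.Disjoint P.1.support Q.1.support

/-- **The combinatorial core of the crux at fugacity `x`**: for every subgraph `H` of `ℤ²` with finitely
many non-isolated vertices and every quadruple satisfying (i) interlacing, (ii) `(p₁p₂|p₃p₄)` and
(iii) `(p₁p₄|p₂p₃)` disjointly realisable, the crossing pairing weighs at most the nested one:
`Z(p₁,p₃) Z(p₂,p₄) ≤ Z(p₁,p₂) Z(p₃,p₄)`. Statement interface of the line's registered stub (the crux's
combinatorial core); nothing is asserted here. [folklore] -/
def GraphTP2At (x : ℝ) : Prop :=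
  ∀ H : SimpleGraph (Site 2), H ≤ zdGraph 2 → H.support.Finite →
    ∀ p₁ p₂ p₃ p₄ : Site 2, Interlaced H p₁ p₂ p₃ p₄ →
      DisjointPaths H p₁ p₂ p₃ p₄ → DisjointPaths H p₁ p₄ p₂ p₃ →
        pathKernel H x p₁ p₃ * pathKernel H x p₂ p₄ ≤ pathKernel H x p₁ p₂ * pathKernel H x p₃ p₄

/-- **Interlacing-only TP₂ at fugacity `x`** (the strengthening an induction on `H` must carry): for every
subgraph `H ≤ zdGraph 2` with finitely many non-isolated vertices and every quadruple of pairwise distinct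
vertices satisfying (i) interlacing, `Z(p₁,p₃) Z(p₂,p₄) ≤ Z(p₁,p₂) Z(p₃,p₄)`. It implies `GraphTP2At x`
(hypotheses (ii), (iii) force pairwise distinctness). Statement interface; nothing is asserted here.
[folklore] -/
def InterlacedTP2At (x : ℝ) : Prop :=
  ∀ H : SimpleGraph (Site 2), H ≤ zdGraph 2 → H.support.Finite →
    ∀ p₁ p₂ p₃ p₄ : Site 2, p₁ ≠ p₂ → p₁ ≠ p₃ → p₁ ≠ p₄ → p₂ ≠ p₃ → p₂ ≠ p₄ → p₃ ≠ p₄ →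
      Interlaced H p₁ p₂ p₃ p₄ →
        pathKernel H x p₁ p₃ * pathKernel H x p₂ p₄ ≤ pathKernel H x p₁ p₂ * pathKernel H x p₃ p₄

end Summit.CriticalPhenomena.SAWScalingLimit.Theorems.BoundaryTP2
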